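import Summits.QuantumFields.BalabanUV.T4Continuum.Spine.NE9.DirectPairingCrossoverEffective

/-!
# T⁴ programme, spine estimate NE9 — WHAT A GIVEN E-SIDE ENVELOPE BUYS ON THE KING ROUTE: a geometric envelope gives a GEOMETRIC rate in the number of
# steps (ratio `max(a^p, θ^qΛ^p)` per `p + q` steps), a polynomial envelope `(j+1)^{−p}` a POLYNOMIAL rate with exponent loss `log(1∕a) : log Λ` — census item
# C44 (b) of cell `pub-balaban-gaps`, seat ne9 (gen 13)

Cell `pub-balaban-gaps` (YM blitz G2, seat ne9, unit `pub-balaban-gaps-ne9-g13`; record `run/shared/lean/pub/pub-balaban-gaps/ne/NE9.md` §5 row C44).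
Summits-side bookkeeping; sequel of `DirectPairingCrossoverEffective` (C44 (a): the interpolation inequality `Σ_{j+n=K} min(s, b_jΛⁿ) ≤ Σ_{i≥N+1} c_i + β·Σ_{n≤N}Λⁿ`
and the `(ε, K)` bookkeeping of King's crossover).  NO definition; nothing of Bałaban's asserted.

WHY.  C44 (a) made the King route's continuum-limit error explicit in the printed scalars up to ONE datum, a decay envelope of the E-side scale profile `b`,
and showed that a merely qualitative profile yields `K(ε)` and nothing better.  The census says what envelope Bałaban's `E^{(j)}` would have GIVEN tower-NE5 and
W1's young-coupling moduli: GEOMETRIC `b_j ≤ Cθ^j` from Hölder moduli (C24∕C25∕C27), POLYNOMIAL `b_j ≤ D(j+1)^{−p}` in the consecutive log window's reading (C42,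
`DirectPairingRate`).  This file reads off, in closed form, the rate each buys on the King route:
* §1 `crossoverE_le_geometric`: one cut — `Σ_{j+n=K} min(E₁aⁿ, b_jΛⁿ) ≤ E₁a^{N+1}∕(1−a) + Cθ^{K−N}(N+1)Λ^N` (`Λ ≥ 1`);
* §2 `crossoverE_le_geometric_blocks`: split `K = (p+q)M + r` (`r < p+q`) as `N = pM + r` size-branch scales and `K − N = qM` rate-branch scales:
  `Σ ≤ (E₁a∕(1−a))·(a^p)^M + C·Λ^{p+q}·(p+q)(M+1)·(θ^qΛ^p)^M` — GEOMETRIC in the block count `M = ⌊K∕(p+q)⌋` with ratio `max(a^p, θ^qΛ^p)` (times a linear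
  factor), natural-number bookkeeping only;
* §3 `exists_pow_mul_pow_lt_one`: for every `p` some `q` has `θ^qΛ^p < 1` as soon as `θ < 1` — the rate is genuinely geometric for a suitable split (optimal split,
  informally: `a = L^{−β}`, `θ = L^{−γ}`, `Λ = L⁴` ⇒ per-step ratio `≈ L^{−βγ∕(β+γ+4)}` — prose only);
* §4 `crossoverE_le_polynomial`: one cut — `b_j ≤ D(j+1)^{−p}` ⇒ `Σ ≤ E₁a^{N+1}∕(1−a) + D(K−N+1)^{−p}(N+1)Λ^N`;
* §5 `crossoverE_le_polynomial_logCut`: at the logarithmic UV cut `N = ⌊c log(K+1)⌋` (`2N ≤ K+1`):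
  `Σ ≤ (E₁∕(1−a))(K+1)^{c log a} + D·2^p(c log(K+1) + 1)(K+1)^{−(p − c log Λ)}`; `balanced_exponent`: `c = p∕(log Λ − log a)` equalises the two exponents, rate
  `(K+1)^{−p·log(1∕a)∕(log(1∕a)+log Λ)}` up to the logarithm — for `a = L^{−β}`, `Λ = L⁴` the envelope's exponent `p` is degraded by the factor `β∕(β+4)`.  COMPARE C42
  (`DirectPairingRate.logWindow_tendsto_of_polyRate`): on the CONSECUTIVE log window a polynomial profile passes node U5b only if `p > C·log Λ`; on the King route EVERY
  `p > 0` passes (C39) and buys this explicit rate.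

VERDICT FOR THE ROW (census C44 (b)).  On the King route the E-side envelope is converted into a continuum-limit rate of the block observable's generating function
(`DirectPairingCrossoverEffective.abs_genFun_sub_lim_le_window` with this file's bounds in the E-slot) by explicit formulas in the printed `a`, `Λ` and the envelope's
parameters: geometric ⇒ exponential (ratio `max(a^p, θ^qΛ^p)^{1∕(p+q)}` per step), polynomial `p` ⇒ polynomial `p·log(1∕a)∕(log(1∕a)+log Λ)`, qualitative ⇒ `K(ε)` only
(C44 (a), two-sided).  The envelope itself is tower-NE5's rate composed with W1's young-coupling moduli — NOT in print for Bałaban's `E^{(j)}`, NOT proved; NOTHING new is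
owed; CLASSIFICATION OF NE9 UNCHANGED: WORK-bound (W1 = the one-step renormalization transformation as a Lean object; instance 0∕1).

HONEST FRAMING: bookkeeping for rung (B)+1 on ONE FIXED finite four-torus; elementary real analysis (finite sums, powers, one logarithm) on hypothesis SHAPES; (2.43)
is Bałaban's printed Theorem 2 of [III], displayed as the SHAPE of a size branch and NOT proved here; the envelopes are HYPOTHESIS shapes (what tower-NE5 — the cell's
estimate NE5, NOT PRINTED, NOT PROVED — composed with W1's moduli would give); every ratio ∕ exponent this file makes explicit is a MODEL-level formula, not a
certified constant of Bałaban's; printed precedent for a rate of this two-term kind exists only for d = 3 ([King1986] Thm 3.4 (3.9) p. 656, (3.12)–(3.13) p. 657);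
NE9 NOT PRINTED ∕ NOT PROVED; spine PROVED 0∕9 unchanged; NOT UV stability, NOT the continuum limit, NOT infinite volume, NOT a mass gap, NOT Clay.  HONEST
DEPENDENCY: continuum YM on T⁴ ⇐ BetaPertH ∧ nine spine estimates (0∕9 proved); BetaPertH ⇐ (D1) ∧ (D4) ∧ CAP+tail.

References (TYPES only): [Balaban1988Convergent] = T. Bałaban, Commun. Math. Phys. **119** (1988) 243–285, Thm 2 (2.43) p. 263; [King1986] = C. King,
Commun. Math. Phys. **102** (1986) 649–677, Thm 3.4 (3.9) p. 656, p. 657.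
-/

namespace Summit.QuantumFields.BalabanUV.T4Continuum.NE9.DirectPairingCrossoverEnvelope

open scoped BigOperators
open Finset Filter Topology
open Summit.QuantumFields.BalabanUV.T4Continuum.NE9.DirectPairingCrossoverEffective (crossoverE_le_window entropy_le_card_mul)

/-! ## §1 One cut: the window bound of a geometric envelope -/

/-- **GEOMETRIC ENVELOPE, ONE CUT.**  If the profile has a geometric envelope `b_j ≤ C·θ^j` (`C ≥ 0`, `0 ≤ θ ≤ 1` — what tower-NE5 composed with Hölder
young-coupling moduli gives, census C24∕C25), `Λ ≥ 1`, `0 ≤ E₁`, `0 ≤ a < 1` and any cut `N`, then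
`Σ_{j+n=K} min(E₁aⁿ, b_jΛⁿ) ≤ E₁a^{N+1}∕(1−a) + C·θ^{K−N}·(N+1)·Λ^N` (`DirectPairingCrossoverEffective.crossoverE_le_window` with `β = Cθ^{K−N}` and `entropy_le_card_mul`). [folklore] -/
theorem crossoverE_le_geometric {E₁ a Λ C θ : ℝ} {b : ℕ → ℝ} {K N : ℕ} (hE₁ : 0 ≤ E₁) (ha0 : 0 ≤ a) (ha1 : a < 1)
    (hΛ : 1 ≤ Λ) (hC : 0 ≤ C) (hθ0 : 0 ≤ θ) (hθ1 : θ ≤ 1) (hb : ∀ j, b j ≤ C * θ ^ j) :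
    ∑ p ∈ antidiagonal K, min (E₁ * a ^ p.2) (b p.1 * Λ ^ p.2)
      ≤ E₁ * a ^ (N + 1) / (1 - a) + C * θ ^ (K - N) * (((N : ℝ) + 1) * Λ ^ N) := by
  have hβ0 : 0 ≤ C * θ ^ (K - N) := mul_nonneg hC (pow_nonneg hθ0 _)
  have h := crossoverE_le_window (b := b) (K := K) (N := N) (β := C * θ ^ (K - N)) hE₁ ha0 ha1 (zero_le_one.trans hΛ) hβ0
    fun j hj _ => (hb j).trans (mul_le_mul_of_nonneg_left (pow_le_pow_of_le_one hθ0 hθ1 hj) hC)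
  have he := mul_le_mul_of_nonneg_left (entropy_le_card_mul hΛ N) hβ0
  linarith

/-! ## §2 Blocks of `p + q` steps: a geometric rate along `K` -/

/-- **GEOMETRIC ENVELOPE ⇒ GEOMETRIC RATE IN `K`.**  Split the `K = (p+q)·M + r` steps (`r < p + q`) as `N = p·M + r` remaining-scale terms on the size branch
and `K − N = q·M` on the rate branch: `Σ_{j+n=K} min(E₁aⁿ, b_jΛⁿ) ≤ (E₁a∕(1−a))·(a^p)^M + C·Λ^{p+q}·((p+q)(M+1))·(θ^qΛ^p)^M` — along `K` the King crossover
decays geometrically with ratio `max(a^p, θ^qΛ^p)` per block of `p + q` steps whenever `θ^q·Λ^p < 1` (such `q` exists for every `p` as soon as `θ < 1`: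
`exists_pow_mul_pow_lt_one`).  With `DirectPairingCrossoverEffective.abs_genFun_sub_lim_le_window`: a geometric E-side envelope makes the King route's continuum-limit error EXPONENTIALLY small in the number of steps,
with an explicit ratio in the printed `a = L^{−β}`, `Λ = L⁴` and the envelope's `θ`; a merely qualitative profile gives only `K(ε)` (`…Effective.crossoverE_le_of_log_scales`) and nothing better (`…Effective.uvCut_term_le_crossoverE`, C39's `profile_le_crossover`).
[folklore] -/
theorem crossoverE_le_geometric_blocks {E₁ a Λ C θ : ℝ} {b : ℕ → ℝ} {K p q M r : ℕ} (hE₁ : 0 ≤ E₁) (ha0 : 0 ≤ a)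
    (ha1 : a < 1) (hΛ : 1 ≤ Λ) (hC : 0 ≤ C) (hθ0 : 0 ≤ θ) (hθ1 : θ ≤ 1) (hb : ∀ j, b j ≤ C * θ ^ j)
    (hK : K = (p + q) * M + r) (hr : r < p + q) :
    ∑ x ∈ antidiagonal K, min (E₁ * a ^ x.2) (b x.1 * Λ ^ x.2)
      ≤ E₁ * a / (1 - a) * (a ^ p) ^ M + C * Λ ^ (p + q) * (((p : ℝ) + q) * ((M : ℝ) + 1)) * (θ ^ q * Λ ^ p) ^ M := by
  have h1a : 0 < 1 - a := by linarith
  have hΛ0 : 0 ≤ Λ := by linarith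
  have h := crossoverE_le_geometric (b := b) (K := K) (N := p * M + r) hE₁ ha0 ha1 hΛ hC hθ0 hθ1 hb
  have hKN : K - (p * M + r) = q * M := by
    rw [hK]
    have : (p + q) * M + r = q * M + (p * M + r) := by ring
    omega
  rw [hKN] at h
  -- the size branch: `a^{pM+r+1} ≤ a^{pM+1} = a·(a^p)^M`
  have hA : E₁ * a ^ (p * M + r + 1) / (1 - a) ≤ E₁ * a / (1 - a) * (a ^ p) ^ M := by
    have hpow : a ^ (p * M + r + 1) ≤ a ^ (p * M + 1) := pow_le_pow_of_le_one ha0 ha1.le (by omega)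
    have heq : E₁ * a / (1 - a) * (a ^ p) ^ M = E₁ * a ^ (p * M + 1) / (1 - a) := by
      rw [← pow_mul, pow_succ]; ring
    rw [heq]
    exact div_le_div_of_nonneg_right (mul_le_mul_of_nonneg_left hpow hE₁) h1a.le
  -- the rate branch: `θ^{qM}·(pM+r+1)·Λ^{pM+r} ≤ Λ^{p+q}·(p+q)(M+1)·(θ^qΛ^p)^M`
  have hB : C * θ ^ (q * M) * ((((p * M + r : ℕ) : ℝ) + 1) * Λ ^ (p * M + r))
      ≤ C * Λ ^ (p + q) * (((p : ℝ) + q) * ((M : ℝ) + 1)) * (θ ^ q * Λ ^ p) ^ M := by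
    have hcnt : (((p * M + r : ℕ) : ℝ) + 1) ≤ ((p : ℝ) + q) * ((M : ℝ) + 1) := by
      have h' : p * M + r + 1 ≤ (p + q) * (M + 1) := by nlinarith
      exact_mod_cast h'
    have hΛpow : Λ ^ (p * M + r) ≤ Λ ^ (p + q) * (Λ ^ p) ^ M := by
      rw [← pow_mul, ← pow_add]
      exact pow_le_pow_right₀ hΛ (by nlinarith)
    have hθq : θ ^ (q * M) = (θ ^ q) ^ M := pow_mul θ q M
    have hcnt0 : 0 ≤ (((p * M + r : ℕ) : ℝ) + 1) := by positivity
    calc C * θ ^ (q * M) * ((((p * M + r : ℕ) : ℝ) + 1) * Λ ^ (p * M + r))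
        ≤ C * θ ^ (q * M) * ((((p : ℝ) + q) * ((M : ℝ) + 1)) * (Λ ^ (p + q) * (Λ ^ p) ^ M)) := by
          refine mul_le_mul_of_nonneg_left ?_ (mul_nonneg hC (pow_nonneg hθ0 _))
          exact mul_le_mul hcnt hΛpow (pow_nonneg hΛ0 _) (by positivity)
      _ = C * Λ ^ (p + q) * (((p : ℝ) + q) * ((M : ℝ) + 1)) * (θ ^ q * Λ ^ p) ^ M := by
          rw [hθq, mul_pow]; ring
  linarith

/-! ## §3 The block ratio is `< 1` for a suitable split -/

/-- For `0 ≤ θ < 1`, `Λ` arbitrary and every `p`, some `q` has `θ^q·Λ^p < 1` — the block ratio of `crossoverE_le_geometric_blocks` is `< 1` for a suitable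
split as soon as the envelope's `θ` is `< 1`. [folklore] -/
theorem exists_pow_mul_pow_lt_one {θ Λ : ℝ} (hθ0 : 0 ≤ θ) (hθ1 : θ < 1) (p : ℕ) : ∃ q : ℕ, θ ^ q * Λ ^ p < 1 := by
  rcases le_or_gt (Λ ^ p) 0 with hΛ | hΛ
  · exact ⟨0, by rw [pow_zero, one_mul]; linarith⟩
  · have h := (tendsto_pow_atTop_nhds_zero_of_lt_one hθ0 hθ1).mul_const (Λ ^ p)
    rw [zero_mul] at h
    obtain ⟨q, hq⟩ := (h.eventually (gt_mem_nhds (show (0 : ℝ) < 1 by norm_num))).exists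
    exact ⟨q, hq⟩

/-! ## §4 A polynomial envelope: one cut -/

/-- **POLYNOMIAL ENVELOPE, ONE CUT.**  If `b_j ≤ D·(j+1)^{−p}` (`D ≥ 0`, `p ≥ 0` — the consecutive log window's currency, C42 `DirectPairingRate`), `Λ ≥ 1`,
`0 ≤ E₁`, `0 ≤ a < 1`, then for every cut `N`: `Σ_{j+n=K} min(E₁aⁿ, b_jΛⁿ) ≤ E₁a^{N+1}∕(1−a) + D·(K−N+1)^{−p}·(N+1)·Λ^N`. [folklore] -/
theorem crossoverE_le_polynomial {E₁ a Λ D p : ℝ} {b : ℕ → ℝ} {K N : ℕ} (hE₁ : 0 ≤ E₁) (ha0 : 0 ≤ a) (ha1 : a < 1)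
    (hΛ : 1 ≤ Λ) (hD : 0 ≤ D) (hp : 0 ≤ p) (hb : ∀ j : ℕ, b j ≤ D * ((j : ℝ) + 1) ^ (-p)) :
    ∑ x ∈ antidiagonal K, min (E₁ * a ^ x.2) (b x.1 * Λ ^ x.2)
      ≤ E₁ * a ^ (N + 1) / (1 - a) + D * (((K - N : ℕ) : ℝ) + 1) ^ (-p) * (((N : ℝ) + 1) * Λ ^ N) := by
  have hβ0 : 0 ≤ D * (((K - N : ℕ) : ℝ) + 1) ^ (-p) := mul_nonneg hD (Real.rpow_nonneg (by positivity) _)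
  have h := crossoverE_le_window (b := b) (K := K) (N := N) (β := D * (((K - N : ℕ) : ℝ) + 1) ^ (-p)) hE₁ ha0 ha1
    (zero_le_one.trans hΛ) hβ0 fun j hj _ => (hb j).trans (mul_le_mul_of_nonneg_left
      (Real.rpow_le_rpow_of_nonpos (by positivity) (by exact_mod_cast Nat.add_le_add_right hj 1) (by linarith)) hD)
  have he := mul_le_mul_of_nonneg_left (entropy_le_card_mul hΛ N) hβ0
  linarith

/-! ## §5 A polynomial envelope at the logarithmic cut: a polynomial rate with an explicit exponent loss -/

/-- **POLYNOMIAL ENVELOPE ⇒ POLYNOMIAL RATE, EXPONENT LOSS `log(1∕a) : log Λ`.**  `0 < a < 1`, `Λ ≥ 1`, `0 ≤ E₁`, `D ≥ 0`, `p ≥ 0`, `c ≥ 0`,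
`b_j ≤ D(j+1)^{−p}`; at the logarithmic UV cut `N = ⌊c·log(K+1)⌋` (admissible as soon as `2N ≤ K + 1`):
`Σ_{j+n=K} min(E₁aⁿ, b_jΛⁿ) ≤ (E₁∕(1−a))·(K+1)^{c·log a} + D·2^p·(c·log(K+1) + 1)·(K+1)^{−(p − c·log Λ)}` — the size branch contributes `(K+1)^{−c log(1∕a)}`,
the rate branch `(K+1)^{−(p − c log Λ)}` up to a logarithm; balancing (`balanced_exponent`: `c = p∕(log Λ − log a)`) gives the rate `(K+1)^{−p·log(1∕a)∕(log(1∕a) + log Λ)}`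
— for `a = L^{−β}`, `Λ = L⁴` the exponent `p` of the E-side envelope is degraded by the factor `β∕(β + 4)`.  Compare C42 (`DirectPairingRate.logWindow_tendsto_of_polyRate`):
on the CONSECUTIVE log window a polynomial profile passes node U5b only if `p > C·log Λ`; on the King route EVERY `p > 0` passes (C39) and buys this rate. [folklore] -/
theorem crossoverE_le_polynomial_logCut {E₁ a Λ D p c : ℝ} {b : ℕ → ℝ} {K : ℕ} (hE₁ : 0 ≤ E₁) (ha0 : 0 < a) (ha1 : a < 1)
    (hΛ : 1 ≤ Λ) (hD : 0 ≤ D) (hp : 0 ≤ p) (hc : 0 ≤ c) (hb : ∀ j : ℕ, b j ≤ D * ((j : ℝ) + 1) ^ (-p))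
    (hK : 2 * ⌊c * Real.log ((K : ℝ) + 1)⌋₊ ≤ K + 1) :
    ∑ x ∈ antidiagonal K, min (E₁ * a ^ x.2) (b x.1 * Λ ^ x.2)
      ≤ E₁ / (1 - a) * ((K : ℝ) + 1) ^ (c * Real.log a)
        + D * (2 : ℝ) ^ p * (c * Real.log ((K : ℝ) + 1) + 1) * ((K : ℝ) + 1) ^ (-(p - c * Real.log Λ)) := by
  set N : ℕ := ⌊c * Real.log ((K : ℝ) + 1)⌋₊ with hN
  have hK1 : (0 : ℝ) < (K : ℝ) + 1 := by positivity
  have h1a : 0 < 1 - a := by linarith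
  have hΛ0 : 0 < Λ := by linarith
  have hlog0 : 0 ≤ c * Real.log ((K : ℝ) + 1) := mul_nonneg hc (Real.log_nonneg (by linarith))
  have hNle : (N : ℝ) ≤ c * Real.log ((K : ℝ) + 1) := Nat.floor_le hlog0
  have hNlt : c * Real.log ((K : ℝ) + 1) < (N : ℝ) + 1 := Nat.lt_floor_add_one _
  have hNK : N ≤ K := by omega
  -- one cut
  have h0 := crossoverE_le_polynomial (b := b) (K := K) (N := N) hE₁ ha0.le ha1 hΛ hD hp hb
  -- the size branch at the log cut: `a^{N+1} ≤ a^{c log(K+1)} = (K+1)^{c log a}`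
  have hA : E₁ * a ^ (N + 1) / (1 - a) ≤ E₁ / (1 - a) * ((K : ℝ) + 1) ^ (c * Real.log a) := by
    have h1 : a ^ (N + 1) ≤ ((K : ℝ) + 1) ^ (c * Real.log a) := by
      calc a ^ (N + 1) = a ^ (((N + 1 : ℕ) : ℝ)) := (Real.rpow_natCast a (N + 1)).symm
        _ ≤ a ^ (c * Real.log ((K : ℝ) + 1)) :=
            Real.rpow_le_rpow_of_exponent_ge ha0 ha1.le (by push_cast; exact hNlt.le)
        _ = ((K : ℝ) + 1) ^ (c * Real.log a) := by
            rw [Real.rpow_def_of_pos ha0, Real.rpow_def_of_pos hK1]; congr 1; ring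
    have h2 := mul_le_mul_of_nonneg_left h1 hE₁
    rw [div_le_iff₀ h1a]
    calc E₁ * a ^ (N + 1) ≤ E₁ * ((K : ℝ) + 1) ^ (c * Real.log a) := h2
      _ = E₁ / (1 - a) * ((K : ℝ) + 1) ^ (c * Real.log a) * (1 - a) := by field_simp
  -- the rate branch at the log cut
  have hB1 : (((K - N : ℕ) : ℝ) + 1) ^ (-p) ≤ (2 : ℝ) ^ p * ((K : ℝ) + 1) ^ (-p) := by
    have hcast : (((K - N : ℕ) : ℝ)) = (K : ℝ) - N := by rw [Nat.cast_sub hNK]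
    have h2N : 2 * (N : ℝ) ≤ (K : ℝ) + 1 := by exact_mod_cast hK
    have hge : ((K : ℝ) + 1) / 2 ≤ ((K - N : ℕ) : ℝ) + 1 := by rw [hcast]; linarith
    calc (((K - N : ℕ) : ℝ) + 1) ^ (-p) ≤ (((K : ℝ) + 1) / 2) ^ (-p) :=
          Real.rpow_le_rpow_of_nonpos (by positivity) hge (by linarith)
      _ = (2 : ℝ) ^ p * ((K : ℝ) + 1) ^ (-p) := by
          rw [Real.div_rpow hK1.le (by norm_num), Real.rpow_neg (by norm_num : (0:ℝ) ≤ 2), div_inv_eq_mul, mul_comm]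
  have hB2 : Λ ^ N ≤ ((K : ℝ) + 1) ^ (c * Real.log Λ) := by
    calc Λ ^ N = Λ ^ ((N : ℕ) : ℝ) := (Real.rpow_natCast Λ N).symm
      _ ≤ Λ ^ (c * Real.log ((K : ℝ) + 1)) := Real.rpow_le_rpow_of_exponent_le hΛ hNle
      _ = ((K : ℝ) + 1) ^ (c * Real.log Λ) := by
          rw [Real.rpow_def_of_pos hΛ0, Real.rpow_def_of_pos hK1]; congr 1; ring
  have hB3 : (N : ℝ) + 1 ≤ c * Real.log ((K : ℝ) + 1) + 1 := by linarith
  have hB : D * (((K - N : ℕ) : ℝ) + 1) ^ (-p) * (((N : ℝ) + 1) * Λ ^ N)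
      ≤ D * (2 : ℝ) ^ p * (c * Real.log ((K : ℝ) + 1) + 1) * ((K : ℝ) + 1) ^ (-(p - c * Real.log Λ)) := by
    have e1 : ((K : ℝ) + 1) ^ (-p) * ((K : ℝ) + 1) ^ (c * Real.log Λ) = ((K : ℝ) + 1) ^ (-(p - c * Real.log Λ)) := by
      rw [← Real.rpow_add hK1]; congr 1; ring
    calc D * (((K - N : ℕ) : ℝ) + 1) ^ (-p) * (((N : ℝ) + 1) * Λ ^ N)
        ≤ D * ((2 : ℝ) ^ p * ((K : ℝ) + 1) ^ (-p)) * ((c * Real.log ((K : ℝ) + 1) + 1) * ((K : ℝ) + 1) ^ (c * Real.log Λ)) := by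
          refine mul_le_mul (mul_le_mul_of_nonneg_left hB1 hD) (mul_le_mul hB3 hB2 (pow_nonneg hΛ0.le _) (by linarith))
            (by positivity) (by positivity)
      _ = D * (2 : ℝ) ^ p * (c * Real.log ((K : ℝ) + 1) + 1) * (((K : ℝ) + 1) ^ (-p) * ((K : ℝ) + 1) ^ (c * Real.log Λ)) := by
          ring
      _ = D * (2 : ℝ) ^ p * (c * Real.log ((K : ℝ) + 1) + 1) * ((K : ℝ) + 1) ^ (-(p - c * Real.log Λ)) := by rw [e1]
  linarith

/-- **THE BALANCED CUT.**  With `c = p∕(log Λ − log a)` (`0 < a < 1 ≤ Λ`, so `log Λ − log a > 0`) the two exponents of `crossoverE_le_polynomial_logCut` coincide: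
`c·log a = −(p − c·log Λ)` — the rate is `(K+1)^{−p·log(1∕a)∕(log(1∕a) + log Λ)}` up to the logarithm; `a = L^{−β}`, `Λ = L⁴` ⇒ exponent `−p·β∕(β+4)`. [folklore] -/
theorem balanced_exponent {a Λ p c : ℝ} (ha0 : 0 < a) (ha1 : a < 1) (hΛ : 1 ≤ Λ) (hc : c = p / (Real.log Λ - Real.log a)) :
    c * Real.log a = -(p - c * Real.log Λ) := by
  have hla : Real.log a < 0 := Real.log_neg ha0 ha1
  have hlΛ : 0 ≤ Real.log Λ := Real.log_nonneg hΛ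
  have hden : Real.log Λ - Real.log a ≠ 0 := by
    have : 0 < Real.log Λ - Real.log a := by linarith
    exact this.ne'
  rw [hc]
  field_simp
  ring

end Summit.QuantumFields.BalabanUV.T4Continuum.NE9.DirectPairingCrossoverEnvelope
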